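import Literature.AlgebraicTopology.SingularHomology.CohomologyFiniteness
import HarnessLib

/-!
# Singular cohomology of a compact manifold is finitely generated over every Noetherian ring
(discharge of `finite_singularCohomology_of_compactSpace`)

A. Hatcher, *Algebraic Topology* (2002), §3.1, Thm. 3.2 and Cor. 3.3 (pp. 195–196), with
Appendix A, Cor. A.8–A.9 (p. 527): the cohomology `Hᵏ(X; G)` of a compact manifold is finitely
generated, because `Hₖ(X; ℤ)`, `Hₖ₋₁(X; ℤ)` are finitely generated and
`Hᵏ(X; G) ≅ Hom(Hₖ(X; ℤ), G) ⊕ Ext(Hₖ₋₁(X; ℤ), G)` (universal coefficients over `ℤ`).  The tree's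
`Literature.AlgebraicTopology.SingularHomology.finite_singularCohomology_of_compactSpace_of_isPrincipalIdealRing`
(`…CohomologyFiniteness`) proved the named fact
`Literature.AlgebraicTopology.SingularHomology.finite_singularCohomology_of_compactSpace R X n k`
(`…PoincareDuality`) only for principal ideal domains `R`, running the dual-complex argument over
`R` itself (where the boundaries `Bₖ(X; R) ⊆ Cₖ(X; R)` are projective only when `R` is a PID).
This file proves it for **every Noetherian ring `R`**, as the fact is stated, by running
Hatcher's argument over `ℤ` with coefficients in an `R`-module — the mixed-ring form of the
universal coefficient finiteness:

* `isNoetherian_linearMap_of_finite` (private): for a finitely generated `S`-module `T` and a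
  Noetherian `R`-module `N` with commuting `S`-action, the `R`-module `Hom_S(T, N)` is Noetherian
  (it embeds `R`-linearly in `N^m` by evaluation at generators).
* `Literature.AlgebraicTopology.SingularHomology.exists_fg_ker_lcomp_le_of_smulCommClass`
  (**mixed-ring dual-complex finiteness**, Hatcher §3.1 Cor. 3.3 in finiteness form): for
  `S`-linear `C₂ →d₂ C₁ →d₁ C₀ →d₀ C₋₁` with `d d = 0`, cycles finitely generated modulo boundaries
  at `C₁` and `C₀`, and `range d₀` a projective `S`-module, the cocycles of the `R`-linear dual
  complex `Hom_S(C₀, N) → Hom_S(C₁, N) → Hom_S(C₂, N)` are finitely generated over `R` modulo the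
  coboundaries.  The proof is that of `exists_fg_ker_lcomp_le` (`…DualComplexFiniteness`, the case
  `S = R`) verbatim, the obstruction modules `Hom_S(T₁, N)`, `Hom_S(T₀ ∩ B₀, N)` now being
  Noetherian `R`-modules by the previous lemma.
* `Literature.AlgebraicTopology.SingularHomology.cochainFun_trans_llift_d'`: the cochains
  `Cᵏ(X; N) = (SingularSimplex X k → N)` of the tree's cochain complex are, `R`-linearly,
  `Hom_ℤ(Cₖ(X; ℤ), N)` for the concrete integral chains `Cₖ(X; ℤ) = (SingularSimplex X k →₀ ℤ)`
  (Mathlib's `Finsupp.llift N ℤ R`), the coboundary becoming `LinearMap.lcomp R N ∂`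
  (Hatcher §3.1, "`Cⁿ(X; G) = Hom(Cₙ(X), G)`, `δ = ∂*`").
* `Literature.AlgebraicTopology.SingularHomology.finite_singularCohomology_of_finite_singularHomology_int`
  (**Cor. 3.3, finiteness, any coefficients**): if `Hₙ(X; ℤ)` and `Hₙ₋₁(X; ℤ)` are finitely
  generated abelian groups and `N` is a Noetherian `R`-module then `Hⁿ(X; N)` is a finitely
  generated `R`-module (boundaries in the free `ℤ`-module `Cₙ₋₁(X; ℤ)` are free, Hatcher p. 193,
  by `Submodule.projective_of_isPrincipalIdealRing`).
* `Literature.AlgebraicTopology.SingularHomology.finite_singularCohomology_of_compact_chartedSpace_of_isNoetherian`: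
  for `X` compact Hausdorff with an atlas on `EuclideanSpace ℝ (Fin d)` and `N` a Noetherian
  `R`-module, `Hᵏ(X; N)` is a finitely generated `R`-module
  (`finite_singularHomology_of_compact_chartedSpace ℤ ℤ` of `…CompactManifoldFiniteness`).
* `Literature.AlgebraicTopology.SingularHomology.finite_singularCohomology_of_compactSpace_holds`:
  **discharge of the named fact** for every Noetherian `R`, as stated in `…PoincareDuality`.

## References

* A. Hatcher, *Algebraic Topology*, CUP 2002, §3.1, pp. 191–196, Thm. 3.2, Cor. 3.3; Appendix A,
  Cor. A.8–A.9, p. 527. [HatcherAT2002]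
-/

noncomputable section

open CategoryTheory Limits

universe u v

namespace Literature.AlgebraicTopology.SingularHomology

/-! ### Functionals on a finitely generated module with Noetherian coefficients -/

section MixedDualFinite

variable {S : Type*} [CommRing S] {R : Type*} [CommRing R]
variable {N : Type*} [AddCommGroup N] [Module R N] [Module S N] [SMulCommClass S R N]

/-- If `T` is a finitely generated `S`-module and `N` is a Noetherian `R`-module with an `S`-module
structure commuting with the `R`-action, then the `R`-module `Hom_S(T, N)` is Noetherian:
evaluation at a finite generating family is an `R`-linear injection into `N^m` (private helper; the
step "`Hom(H, G)` for finitely generated `H`" of Hatcher 2002, §3.1, pp. 195–196). [folklore] -/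
private theorem isNoetherian_linearMap_of_finite {T : Type*} [AddCommGroup T] [Module S T]
    [Module.Finite S T] [IsNoetherian R N] : IsNoetherian R (T →ₗ[S] N) := by
  obtain ⟨m, t, ht⟩ := Module.Finite.exists_fin (R := S) (M := T)
  let ev : (T →ₗ[S] N) →ₗ[R] (Fin m → N) :=
    { toFun := fun φ i ↦ φ (t i)
      map_add' := fun _ _ ↦ rfl
      map_smul' := fun _ _ ↦ rfl }
  refine isNoetherian_of_injective ev fun φ ψ h ↦ ?_
  exact LinearMap.ext_on_range ht fun i ↦ congr_fun h i

variable {C₂ C₁ C₀ Cm : Type*} [AddCommGroup C₂] [Module S C₂] [AddCommGroup C₁] [Module S C₁]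
  [AddCommGroup C₀] [Module S C₀] [AddCommGroup Cm] [Module S Cm]

/-- **Finite generation of the cohomology of the dual complex, mixed-ring form** (the finiteness
content of Hatcher 2002, §3.1, Cor. 3.3, proof pp. 191–195, for a complex over `S` dualised into a
Noetherian `R`-module `N`).  For `S`-linear maps `C₂ →d₂ C₁ →d₁ C₀ →d₀ C₋₁` with
`d₁ d₂ = 0 = d₀ d₁`, cycles finitely generated modulo boundaries at `C₁` and at `C₀`, and
`range d₀` projective, the cocycles `ker (d₂*)` of the `R`-linear dual complex
`Hom_S(C₀, N) →d₁* Hom_S(C₁, N) →d₂* Hom_S(C₂, N)` (`d* = LinearMap.lcomp R N d`) are finitely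
generated over `R` modulo the coboundaries `range (d₁*)`.  The case `S = R` is
`exists_fg_ker_lcomp_le`; the proof is the same: a cocycle is determined on `Z₁ = ker d₁` by its
restriction to a finitely generated `T₁`; cocycles vanishing on `Z₁` are `θ ∘ d₁`; such a `θ` is a
coboundary once it extends to `Z₀`, a retract of `C₀` (`exists_retraction_ker`), and it extends iff
it does from `T₀ ∩ B₀` to `T₀` (`exists_extension_of_vanishing`); the obstructions live in the
Noetherian `R`-modules `Hom_S(T₁, N)`, `Hom_S(T₀ ∩ B₀, N)` (`isNoetherian_linearMap_of_finite`,
`exists_fg_forall_sub_mem_ker`). [cite: HatcherAT2002, §3.1 Cor. 3.3] -/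
theorem exists_fg_ker_lcomp_le_of_smulCommClass [IsNoetherianRing S] [IsNoetherian R N]
    (d₂ : C₂ →ₗ[S] C₁) (d₁ : C₁ →ₗ[S] C₀) (d₀ : C₀ →ₗ[S] Cm)
    (h₁₂ : d₁ ∘ₗ d₂ = 0) (h₀₁ : d₀ ∘ₗ d₁ = 0)
    (hH₁ : ∃ T₁ : Submodule S C₁, T₁.FG ∧ T₁ ≤ LinearMap.ker d₁ ∧
      LinearMap.ker d₁ ≤ T₁ ⊔ LinearMap.range d₂)
    (hH₀ : ∃ T₀ : Submodule S C₀, T₀.FG ∧ T₀ ≤ LinearMap.ker d₀ ∧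
      LinearMap.ker d₀ ≤ T₀ ⊔ LinearMap.range d₁)
    [Module.Projective S (LinearMap.range d₀)] :
    ∃ P : Submodule R (C₁ →ₗ[S] N), P.FG ∧ P ≤ LinearMap.ker (LinearMap.lcomp R N d₂) ∧
      LinearMap.ker (LinearMap.lcomp R N d₂) ≤ P ⊔ LinearMap.range (LinearMap.lcomp R N d₁) := by
  obtain ⟨T₁, hT₁, hT₁Z, hZT₁⟩ := hH₁
  obtain ⟨T₀, hT₀, hT₀Z, hZT₀⟩ := hH₀
  haveI : Module.Finite S T₁ := Module.Finite.iff_fg.mpr hT₁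
  haveI : Module.Finite S ↥(T₀ ⊓ LinearMap.range d₁) :=
    Module.Finite.iff_fg.mpr (hT₀.of_le inf_le_left)
  haveI : IsNoetherian R (T₁ →ₗ[S] N) := isNoetherian_linearMap_of_finite
  haveI : IsNoetherian R (↥(T₀ ⊓ LinearMap.range d₁) →ₗ[S] N) :=
    isNoetherian_linearMap_of_finite
  set Z := LinearMap.ker (LinearMap.lcomp R N d₂) with hZdef
  have hBZ₀ : LinearMap.range d₁ ≤ LinearMap.ker d₀ := by
    rintro _ ⟨c, rfl⟩
    exact LinearMap.congr_fun h₀₁ c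
  -- Part I: restriction of cocycles to `T₁`
  let r : Z →ₗ[R] (T₁ →ₗ[S] N) := (LinearMap.lcomp R N T₁.subtype) ∘ₗ Z.subtype
  obtain ⟨P₁, hP₁, hP₁r⟩ := exists_fg_forall_sub_mem_ker r (IsNoetherian.noetherian _)
  have hvan : ∀ χ : Z, χ ∈ LinearMap.ker r →
      LinearMap.ker d₁ ≤ LinearMap.ker (χ : C₁ →ₗ[S] N) := by
    intro χ hχ z hz
    obtain ⟨t, ht, _, ⟨w, rfl⟩, htw⟩ := Submodule.mem_sup.mp (hZT₁ hz)
    rw [LinearMap.mem_ker, ← htw, map_add]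
    have h1 : (χ : C₁ →ₗ[S] N) t = 0 := LinearMap.congr_fun hχ ⟨t, ht⟩
    have h2 : (χ : C₁ →ₗ[S] N) (d₂ w) = 0 := LinearMap.congr_fun χ.2 w
    rw [h1, h2, add_zero]
  -- Part II: functionals on the boundaries `range d₁`
  let e : (LinearMap.range d₁ →ₗ[S] N) →ₗ[R] (C₁ →ₗ[S] N) :=
    LinearMap.lcomp R N d₁.rangeRestrict
  have hrr : d₁.rangeRestrict ∘ₗ d₂ = 0 := by
    ext x
    exact LinearMap.congr_fun h₁₂ x
  have heZ : ∀ θ, e θ ∈ Z := fun θ ↦ by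
    change (θ ∘ₗ d₁.rangeRestrict) ∘ₗ d₂ = 0
    rw [LinearMap.comp_assoc, hrr, LinearMap.comp_zero]
  let r₀ : (LinearMap.range d₁ →ₗ[S] N) →ₗ[R] (↥(T₀ ⊓ LinearMap.range d₁) →ₗ[S] N) :=
    LinearMap.lcomp R N (Submodule.inclusion inf_le_right)
  obtain ⟨P₂, hP₂, hP₂r⟩ := exists_fg_forall_sub_mem_ker r₀ (IsNoetherian.noetherian _)
  obtain ⟨ρ, hρ⟩ := exists_retraction_ker d₀
  have hext : ∀ θ ∈ LinearMap.ker r₀, e θ ∈ LinearMap.range (LinearMap.lcomp R N d₁) := by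
    intro θ hθ
    obtain ⟨Θ, hΘ⟩ := exists_extension_of_vanishing (N := N) d₁ T₀ (LinearMap.ker d₀) hZT₀ hBZ₀
      θ (fun y hy ↦ LinearMap.congr_fun hθ ⟨y, hy, y.2⟩)
    refine ⟨Θ ∘ₗ ρ, ?_⟩
    ext c
    change Θ (ρ (d₁ c)) = θ (d₁.rangeRestrict c)
    rw [← hΘ]
    congr 1
    exact hρ ⟨d₁ c, hBZ₀ ⟨c, rfl⟩⟩
  -- assembly
  refine ⟨P₁.map Z.subtype ⊔ P₂.map e, (hP₁.map _).sup (hP₂.map _), sup_le ?_ ?_, fun φ hφ ↦ ?_⟩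
  · rintro _ ⟨p, -, rfl⟩; exact p.2
  · rintro _ ⟨θ, -, rfl⟩; exact heZ θ
  obtain ⟨p₁, hp₁, hχ⟩ := hP₁r ⟨φ, hφ⟩
  have hker : LinearMap.ker d₁ ≤ LinearMap.ker (φ - (p₁ : C₁ →ₗ[S] N)) := hvan _ hχ
  -- descend `φ - p₁` (which kills `ker d₁`) to the boundaries `range d₁ ≅ C₁ ⧸ ker d₁`
  let θ : LinearMap.range d₁ →ₗ[S] N :=
    (LinearMap.ker d₁).liftQ _ hker ∘ₗ (d₁.quotKerEquivRange).symm.toLinearMap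
  have hθ : e θ = φ - (p₁ : C₁ →ₗ[S] N) := by
    ext c
    change (LinearMap.ker d₁).liftQ _ hker ((d₁.quotKerEquivRange).symm (d₁.rangeRestrict c)) = _
    have : (d₁.quotKerEquivRange).symm (d₁.rangeRestrict c) = Submodule.Quotient.mk c := by
      rw [LinearEquiv.symm_apply_eq]
      ext
      rw [LinearMap.quotKerEquivRange_apply_mk]
      rfl
    rw [this, Submodule.liftQ_apply]
  obtain ⟨p₂, hp₂, hθ₂⟩ := hP₂r θ
  have : φ = (p₁ : C₁ →ₗ[S] N) + e p₂ + e (θ - p₂) := by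
    rw [map_sub, hθ]; abel
  rw [this]
  exact Submodule.add_mem_sup (Submodule.add_mem_sup ⟨p₁, hp₁, rfl⟩ ⟨p₂, hp₂, rfl⟩)
    (hext _ hθ₂)

end MixedDualFinite

/-! ### Cochains as `ℤ`-duals of the integral chains, with their `R`-module structure -/

section CochainIntDual

-- as in `SingularChainsConcrete`: chains of the concrete complex are `Finsupp`s up to unfolding
set_option backward.isDefEq.respectTransparency false

variable (R : Type v) [CommRing R] (N : Type v) [AddCommGroup N] [Module R N]
variable {X : Type u} [TopologicalSpace X]

/-- **`Cᵏ(X; N) ≃ₗ[R] Hom_ℤ(Cₖ(X; ℤ), N)`** on an elementary integral chain: the `R`-linear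
equivalence `(cochainFun R N k).trans (Finsupp.llift N ℤ R _)` (a function on singular
`k`-simplices extends additively over the free abelian group `Cₖ(X; ℤ) = (SingularSimplex X k →₀ ℤ)`;
Hatcher 2002, §3.1, "`Cⁿ(X; G) = Hom(Cₙ(X), G)`") sends `φ` to the functional with
`ε(φ)(r • σ) = r • φ(σ)`. [cite: HatcherAT2002, §3.1 p. 191] -/
lemma cochainFun_trans_llift_single (k : ℕ) (φ : (singularCochainComplex R N X).X k)
    (σ : SingularSimplex X k) (r : ℤ) :
    ((cochainFun R N k).trans (Finsupp.llift N ℤ R (SingularSimplex X k))) φ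
        (Finsupp.single σ r) = r • cochainFun R N k φ σ := by
  simp [Finsupp.llift_apply, Finsupp.lift_apply]

/-- **The coboundary is the `ℤ`-dual of the integral boundary**: under
`Cᵏ(X; N) ≃ Hom_ℤ(Cₖ(X; ℤ), N)`, `ε(δφ) = ε(φ) ∘ ∂` for the concrete boundary
`csingularChainComplex.bd ℤ` (Hatcher 2002, §3.1, "`δ` is the dual `∂*`"). [cite: HatcherAT2002, §3.1 p. 191] -/
lemma cochainFun_trans_llift_d (k : ℕ) (φ : (singularCochainComplex R N X).X k) :
    ((cochainFun R N (k + 1)).trans (Finsupp.llift N ℤ R (SingularSimplex X (k + 1))))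
        ((singularCochainComplex R N X).d k (k + 1) φ) =
      (((cochainFun R N k).trans (Finsupp.llift N ℤ R (SingularSimplex X k))) φ) ∘ₗ
        (csingularChainComplex.bd ℤ k : CChain ℤ X (k + 1) →ₗ[ℤ] CChain ℤ X k) := by
  refine Finsupp.lhom_ext fun σ r ↦ ?_
  rw [cochainFun_trans_llift_single, cochainFun_d, Finset.smul_sum, LinearMap.comp_apply,
    csingularChainComplex.bd_single, map_sum]
  refine Finset.sum_congr rfl fun i _ ↦ ?_
  rw [map_smul, cochainFun_trans_llift_single, smul_comm, ← Int.cast_smul_eq_zsmul R ((-1 : ℤ) ^ _),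
    Int.cast_pow, Int.cast_neg, Int.cast_one]

/-- `cochainFun_trans_llift_d` with the differential of the concrete integral chain complex
(`csingularChainComplex.d_eq`): `ε(δφ) = (∂)* (ε φ)` with `(∂)* = LinearMap.lcomp R N ∂`, an
`R`-linear map between `ℤ`-duals (Hatcher 2002, §3.1, "`δ = ∂*`", p. 191). [cite: HatcherAT2002, §3.1 p. 191] -/
lemma cochainFun_trans_llift_d' (k : ℕ) (φ : (singularCochainComplex R N X).X k) :
    ((cochainFun R N (k + 1)).trans (Finsupp.llift N ℤ R (SingularSimplex X (k + 1))))
        ((singularCochainComplex R N X).d k (k + 1) φ) =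
      LinearMap.lcomp R N ((csingularChainComplex ℤ ℤ X).d (k + 1) k).hom
        (((cochainFun R N k).trans (Finsupp.llift N ℤ R (SingularSimplex X k))) φ) := by
  rw [LinearMap.lcomp_apply', cochainFun_trans_llift_d, csingularChainComplex.d_eq]
  rfl

/-! ### Finiteness of cohomology from finiteness of integral homology -/

/-- **`H⁰(X; N)` is a finitely generated `R`-module when `H₀(X; ℤ)` is finitely generated** (`N` a
Noetherian `R`-module; Hatcher 2002, §3.1, `H⁰(X; G) = Hom(H₀(X), G)`, p. 198): the mixed-ring
dual-complex theorem with `C₋₁ = C₋₂ = 0`. [cite: HatcherAT2002, §3.1 Cor. 3.3] -/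
theorem finite_singularCohomology_zero_of_int [IsNoetherian R N]
    [Module.Finite ℤ (singularHomology ℤ ℤ X 0)] :
    Module.Finite R (singularCohomology R N X 0) := by
  obtain ⟨T₁, hT₁⟩ := exists_fg_cycles_csingular ℤ X 0 0 ChainComplex.next_nat_zero
  have hd00 : (csingularChainComplex ℤ ℤ X).d 0 0 = 0 :=
    (csingularChainComplex ℤ ℤ X).shape 0 0 (by simp)
  -- the dual-complex theorem with `C₀ = C₋₁ = 0`
  have hA := exists_fg_ker_lcomp_le_of_smulCommClass (R := R) (N := N)
    ((csingularChainComplex ℤ ℤ X).d 1 0).hom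
    (0 : (csingularChainComplex ℤ ℤ X).X 0 →ₗ[ℤ] PUnit.{1})
    (0 : PUnit.{1} →ₗ[ℤ] PUnit.{1}) (LinearMap.zero_comp _) (LinearMap.zero_comp _)
    ⟨T₁, hT₁.1, by simp, by
      rw [LinearMap.ker_zero]
      refine le_trans ?_ hT₁.2.2
      rw [hd00]; simp⟩
    ⟨⊥, Submodule.fg_bot, bot_le, fun x _ ↦ by simp⟩
  refine finite_singularCohomology_of_exists 0 0 CochainComplex.prev_nat_zero
    (exists_fg_ker_le_of_equiv _ _ _ _
      ((cochainFun R N 0).trans (Finsupp.llift N ℤ R (SingularSimplex X 0)))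
      ((cochainFun R N 1).trans (Finsupp.llift N ℤ R (SingularSimplex X 1)))
      (fun φ ↦ cochainFun_trans_llift_d' R N 0 φ) (fun x hx ↦ ?_) hA)
  obtain ⟨θ, hθ⟩ := hx
  have : ((cochainFun R N 0).trans (Finsupp.llift N ℤ R (SingularSimplex X 0))) x = 0 := by
    rw [← hθ, LinearMap.lcomp_apply', LinearMap.comp_zero]
  rw [(LinearEquiv.map_eq_zero_iff _).mp this]
  exact zero_mem _

/-- **`Hʲ⁺¹(X; N)` is a finitely generated `R`-module when `Hⱼ₊₁(X; ℤ)` and `Hⱼ(X; ℤ)` are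
finitely generated** (`N` a Noetherian `R`-module; the finiteness in Hatcher 2002, §3.1,
Cor. 3.3): the mixed-ring dual-complex theorem for the integral chains
`Cⱼ₊₂ → Cⱼ₊₁ → Cⱼ → C_{next j}`, the boundaries in the free abelian group `Cⱼ₋₁(X; ℤ)` being free
(Hatcher p. 193; `Submodule.projective_of_isPrincipalIdealRing`), transported along
`Cᵏ(X; N) ≃ₗ[R] Hom_ℤ(Cₖ(X; ℤ), N)`. [cite: HatcherAT2002, §3.1 Cor. 3.3] -/
theorem finite_singularCohomology_succ_of_int [IsNoetherian R N] (j : ℕ)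
    [Module.Finite ℤ (singularHomology ℤ ℤ X (j + 1))]
    [Module.Finite ℤ (singularHomology ℤ ℤ X j)] :
    Module.Finite R (singularCohomology R N X (j + 1)) := by
  set j' := (ComplexShape.down ℕ).next j
  obtain ⟨T₁, hT₁⟩ := exists_fg_cycles_csingular ℤ X (j + 1) j (ChainComplex.next_nat_succ j)
  obtain ⟨T₀, hT₀⟩ := exists_fg_cycles_csingular ℤ X j j' rfl
  haveI : Module.Free ℤ ((csingularChainComplex ℤ ℤ X).X j') :=
    inferInstanceAs (Module.Free ℤ (CChain ℤ X j'))
  haveI : Module.Projective ℤ (LinearMap.range ((csingularChainComplex ℤ ℤ X).d j j').hom) :=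
    Submodule.projective_of_isPrincipalIdealRing _
  have hA := exists_fg_ker_lcomp_le_of_smulCommClass (R := R) (N := N)
    ((csingularChainComplex ℤ ℤ X).d (j + 2) (j + 1)).hom
    ((csingularChainComplex ℤ ℤ X).d (j + 1) j).hom ((csingularChainComplex ℤ ℤ X).d j j').hom
    (by rw [← ModuleCat.hom_comp, (csingularChainComplex ℤ ℤ X).d_comp_d, ModuleCat.hom_zero])
    (by rw [← ModuleCat.hom_comp, (csingularChainComplex ℤ ℤ X).d_comp_d, ModuleCat.hom_zero])
    ⟨T₁, hT₁⟩ ⟨T₀, hT₀⟩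
  refine finite_singularCohomology_of_exists j (j + 1) (CochainComplex.prev_nat_succ j)
    (exists_fg_ker_le_of_equiv _ _ _ _
      ((cochainFun R N (j + 1)).trans (Finsupp.llift N ℤ R (SingularSimplex X (j + 1))))
      ((cochainFun R N (j + 2)).trans (Finsupp.llift N ℤ R (SingularSimplex X (j + 2))))
      (fun φ ↦ cochainFun_trans_llift_d' R N (j + 1) φ) (fun x hx ↦ ?_) hA)
  obtain ⟨θ, hθ⟩ := hx
  refine ⟨((cochainFun R N j).trans (Finsupp.llift N ℤ R (SingularSimplex X j))).symm θ,
    ((cochainFun R N (j + 1)).trans (Finsupp.llift N ℤ R (SingularSimplex X (j + 1)))).injective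
      ?_⟩
  rw [cochainFun_trans_llift_d' R N j, LinearEquiv.apply_symm_apply]
  exact hθ

/-- **Singular cohomology with any Noetherian coefficients is finitely generated when integral
homology is** (Hatcher 2002, §3.1, Cor. 3.3 (p. 196), finiteness part, via universal
coefficients over `ℤ`): if `Hₙ(X; ℤ)` and `Hₙ₋₁(X; ℤ)` are finitely generated abelian groups and `N`
is a Noetherian `R`-module, then `Hⁿ(X; N)` is a finitely generated `R`-module. [cite: HatcherAT2002, §3.1 Cor. 3.3] -/
theorem finite_singularCohomology_of_finite_singularHomology_int [IsNoetherian R N] (n : ℕ)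
    [Module.Finite ℤ (singularHomology ℤ ℤ X n)]
    (h : ∀ m, m + 1 = n → Module.Finite ℤ (singularHomology ℤ ℤ X m)) :
    Module.Finite R (singularCohomology R N X n) := by
  cases n with
  | zero => exact finite_singularCohomology_zero_of_int R N
  | succ j =>
    haveI := h j rfl
    exact finite_singularCohomology_succ_of_int R N j

/-! ### Cohomology of compact manifolds, every Noetherian coefficient module -/

/-- **The singular cohomology of a compact manifold with coefficients in a Noetherian module is
finitely generated** (Hatcher 2002, App. A, Cor. A.8–A.9 with §3.1, Cor. 3.3): for `X` compact
Hausdorff with an atlas modelled on `EuclideanSpace ℝ (Fin d)` and `N` a Noetherian `R`-module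
(e.g. `R` Noetherian and `N` finitely generated), every `Hᵏ(X; N)` is a finitely generated
`R`-module — `finite_singularHomology_of_compact_chartedSpace ℤ ℤ` (integral homology of a compact
manifold is finitely generated) and `finite_singularCohomology_of_finite_singularHomology_int`.
Compare `finite_singularCohomology_of_compact_chartedSpace` (`R` a PID). [cite: HatcherAT2002, App. A Cor. A.8–A.9 and §3.1 Cor. 3.3] -/
theorem finite_singularCohomology_of_compact_chartedSpace_of_isNoetherian [IsNoetherian R N]
    {d : ℕ} [CompactSpace X] [T2Space X] [ChartedSpace (EuclideanSpace ℝ (Fin d)) X] (k : ℕ) :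
    Module.Finite R (singularCohomology R N X k) :=
  haveI : ∀ m, Module.Finite ℤ (singularHomology ℤ ℤ X m) := fun m ↦
    finite_singularHomology_of_compact_chartedSpace ℤ ℤ (d := d) m
  finite_singularCohomology_of_finite_singularHomology_int R N k fun _ _ ↦ inferInstance

end CochainIntDual

/-- **Discharge of the named fact
`Literature.AlgebraicTopology.SingularHomology.finite_singularCohomology_of_compactSpace`**
(`…PoincareDuality`; Hatcher 2002, App. A, Cor. A.8 and A.9, p. 527, with the universal
coefficient theorem §3.1, Thm. 3.2 / Cor. 3.3), in the generality stated there: for every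
Noetherian commutative ring `R` and every closed topological `n`-manifold `X` (compact Hausdorff,
charted on `EuclideanSpace ℝ (Fin n)`), the cohomology `Hᵏ(X; R)` is a finitely generated
`R`-module (`finite_singularCohomology_of_compact_chartedSpace_of_isNoetherian` with `N = R`).
The earlier `finite_singularCohomology_of_compactSpace_of_isPrincipalIdealRing` is the PID case. [cite: HatcherAT2002, App. A Cor. A.8–A.9 and §3.1 Cor. 3.3] -/
theorem finite_singularCohomology_of_compactSpace_holds :
    ∀ (R : Type v) [CommRing R] (X : Type u) [TopologicalSpace X] (n : ℕ) [IsNoetherianRing R]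
      [CompactSpace X] [T2Space X] [ChartedSpace (EuclideanSpace ℝ (Fin n)) X] (k : ℕ),
      finite_singularCohomology_of_compactSpace R X n k :=
  fun R _ _ _ n _ _ _ _ k ↦
    finite_singularCohomology_of_compact_chartedSpace_of_isNoetherian R R (d := n) k

end Literature.AlgebraicTopology.SingularHomology
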